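import Summits.QuantumAdvantage.QuantumAdvantage.Theorems.CubicForrelationNearExactIsExactAxParity

/-!
# Crux `CubicForrelation.NearExactIsExact` (stmt-QuantumAdvantage-14043) — bias sums of cubic phases modulo the next power of
  two: SATURATED TILINGS, for every `n`

Certificate seat `b2b-cforr-cert` (gen 3; rung `θ₁₆ ≤ 31/32`).  HONEST FRAMING: combinatorial lemmas about cubic Boolean
functions — tools for finite-slice verdicts, NOT summit progress.

This file re-proves, for a general number `n` of variables and a general coordinate set `K`, the "one power of two beyond
Ax" expansion of the landed `Negative/NoCaseATwelve.lean` (which is stated at `n = 12`, `K = univ`, pivot variable `0`):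
* `st_cube_bias_expand`: `Σ_{x ∈ E_K} Π_s (−1)^{[supp s ⊆ supp x]} = Σ_{S ⊆ Mon(p)} [U_S ⊆ K]·(−2)^{|S|}·2^{|K| − |U_S|}`;
* `st_cube_bias_congr`: for `p` of total degree `≤ 3` and `|K| = 3m`, modulo `2^{m+1}` only the SATURATED families survive —
  `m` monomials whose supports tile `K` — so the bias is `(−2)^m · N_m(K) + 2^{m+1} k`;
* `st_saturated_succ_eq_biUnion` / `st_card_saturated_succ`: the perfect-matching recursion of the monomial `3`-graph through a
  PIVOT `j ∈ K`: `N_{m+1}(K) = Σ_{s₀ ∋ j, supp s₀ ⊆ K} N_m(K ∖ supp s₀)` when `|K| = 3(m+1)`;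
* `st_card_saturated_eq_zero`: `N_m(K) = 0` when `|K| > 3m`.
They are used at `n = 16` with `|K| = 15` (`m = 5`) and `|K| = 12` (`m = 4`) in the residual case of the `θ₁₆ ≤ 31/32` rung.

References: R. J. McEliece, Discrete Math. 3 (1972); C. Carlet, *Boolean Functions for Cryptography and Coding Theory*,
CUP 2021, §4.1; F. J. MacWilliams, N. J. A. Sloane, *The Theory of Error-Correcting Codes* (1977), Ch. 15 §3.  Everything
below is proved from Mathlib and the tree; axioms are the standard three.
-/

set_option linter.dupNamespace false -- D-0017: single-problem summit ⇒ `QuantumAdvantage.QuantumAdvantage` by design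

noncomputable section

namespace Summit.QuantumAdvantage.QuantumAdvantage.Theorems.CubicForrelation.NearExactIsExact

open Finset
open Literature.Computability.QuantumComplexity

variable {n : ℕ} (p : MvPolynomial (Fin n) (ZMod 2))

/-! ### The monomial expansion modulo the next power of two -/

/-- The expansion of the integer bias sum of a polynomial phase over a coordinate cube `E_K`:
`Σ_{x ∈ E_K} Π_s (−1)^{[supp s ⊆ supp x]} = Σ_{S ⊆ Mon(p)} [U_S ⊆ K] · (−2)^{|S|} · 2^{|K| − |U_S|}`, `U_S = ⋃_{s∈S} supp s`
(`ax_prod_sign_eq`, `ax_prod_indicator`, `ax_card_cube_sup`). [folklore; McEliece 1972 / Carlet 2021 §4.1] -/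
theorem st_cube_bias_expand (K : Finset (Fin n)) :
    ∑ x ∈ {x : Fin n → Bool | ∀ i, x i = true → i ∈ K},
        ∏ s ∈ p.support, (if (∀ j ∈ s.support, x j = true) then (-1 : ℤ) else 1) =
      ∑ S ∈ p.support.powerset,
        (if (S.biUnion fun s => s.support) ⊆ K then
          (-2 : ℤ) ^ #S * 2 ^ (#K - #(S.biUnion fun s => s.support)) else 0) := by
  simp_rw [ax_prod_sign_eq]
  rw [sum_comm]
  refine sum_congr rfl fun S _ => ?_
  simp_rw [ax_prod_indicator]
  rw [← sum_filter, sum_const, filter_filter, nsmul_eq_mul]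
  by_cases hU : (S.biUnion fun s => s.support) ⊆ K
  · rw [ax_card_cube_sup hU, if_pos hU]
    push_cast
    ring
  · rw [ax_card_cube_sup_eq_zero hU, if_neg hU]
    simp

/-- **Saturated terms.** For `p` of total degree `≤ 3` and `|K| = 3m`, modulo `2^{m+1}` only the sets of `m`
monomials whose supports tile `K` survive:
`Σ_{x ∈ E_K} Π_s (−1)^{[supp s ⊆ supp x]} = (−2)^m · #{S ⊆ Mon(p) : |S| = m, U_S = K} + 2^{m+1} k`
(a term with `|S| = a` and `U_S ⊆ K` has `|U_S| ≤ min(3a, 3m)`, so its exponent `a + 3m − |U_S|` is `≥ m + 1` unless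
`a = m` and `U_S = K`). [folklore; the landed `cube_bias_congr` for every `n` and `K`] -/
theorem st_cube_bias_congr (hp : p.totalDegree ≤ 3) (K : Finset (Fin n)) (m : ℕ) (hK : #K = 3 * m) :
    ∃ k : ℤ, ∑ x ∈ {x : Fin n → Bool | ∀ i, x i = true → i ∈ K},
        ∏ s ∈ p.support, (if (∀ j ∈ s.support, x j = true) then (-1 : ℤ) else 1) =
      (-2 : ℤ) ^ m * (#{S ∈ p.support.powerset | #S = m ∧ (S.biUnion fun s => s.support) = K} : ℕ) +
        2 ^ (m + 1) * k := by
  have h1 : ∀ S ∈ {S ∈ p.support.powerset | #S = m ∧ (S.biUnion fun s => s.support) = K},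
      (if (S.biUnion fun s => s.support) ⊆ K then
        (-2 : ℤ) ^ #S * 2 ^ (#K - #(S.biUnion fun s => s.support)) else 0) = (-2 : ℤ) ^ m := by
    intro S hS
    obtain ⟨-, hSm, hSU⟩ := mem_filter.1 hS
    rw [hSU, if_pos (Subset.refl K), hSm, Nat.sub_self, pow_zero, mul_one]
  have h2 : ∀ S ∈ {S ∈ p.support.powerset | ¬ (#S = m ∧ (S.biUnion fun s => s.support) = K)},
      (2 : ℤ) ^ (m + 1) ∣ (if (S.biUnion fun s => s.support) ⊆ K then
        (-2 : ℤ) ^ #S * 2 ^ (#K - #(S.biUnion fun s => s.support)) else 0) := by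
    intro S hS
    obtain ⟨hSp, hnot⟩ := mem_filter.1 hS
    split_ifs with hU
    · have hUS : #(S.biUnion fun s => s.support) ≤ 3 * #S := ax_card_biUnion_le hp (mem_powerset.1 hSp)
      have hUK : #(S.biUnion fun s => s.support) ≤ #K := card_le_card hU
      have hne : ¬ (#S = m ∧ #(S.biUnion fun s => s.support) = #K) := by
        rintro ⟨hSm, hc⟩
        exact hnot ⟨hSm, eq_of_subset_of_card_le hU hc.ge⟩
      have hexp : m + 1 ≤ #S + (#K - #(S.biUnion fun s => s.support)) := by omega
      rw [neg_pow, mul_assoc, ← pow_add]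
      exact Dvd.dvd.mul_left (pow_dvd_pow 2 hexp) _
    · exact dvd_zero _
  obtain ⟨k, hk⟩ := dvd_sum h2
  refine ⟨k, ?_⟩
  rw [st_cube_bias_expand p K, ← sum_filter_add_sum_filter_not p.support.powerset
    (fun S => #S = m ∧ (S.biUnion fun s => s.support) = K), sum_congr rfl h1, sum_const, nsmul_eq_mul, hk]
  ring

/-- **No saturated family when the set is too big.** If `|K| > 3m` then no `m` monomials of a cubic tile `K`:
`N_m(K) = 0`. [folklore] -/
theorem st_card_saturated_eq_zero (hp : p.totalDegree ≤ 3) (K : Finset (Fin n)) (m : ℕ) (hK : 3 * m < #K) :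
    #{S ∈ p.support.powerset | #S = m ∧ (S.biUnion fun s => s.support) = K} = 0 := by
  rw [card_eq_zero, filter_eq_empty_iff]
  rintro S hSp ⟨hSm, hSU⟩
  have h := ax_card_biUnion_le hp (mem_powerset.1 hSp)
  rw [hSU, hSm] at h
  omega

/-! ### The perfect-matching recursion through a pivot variable -/

/-- **The monomial through a pivot.** For `|K| = 3(m+1)` and a pivot `j ∈ K`, the sets of `m+1` monomials of a cubic whose
supports cover exactly `K` are the disjoint union, over the monomials `s₀ ∋ j` with `supp s₀ ⊆ K`, of `insert s₀` applied
to the sets of `m` monomials whose supports cover exactly `K ∖ supp s₀` (the supports in a covering `(m+1)`-set are forced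
to be pairwise disjoint triples by counting).  This is `pm(V) = Σ_{e ∋ v} pm(V ∖ e)` for perfect matchings of a `3`-uniform
hypergraph; the landed `saturated_four_eq_biUnion` is the case `n = 12`, `K = univ`, `j = 0`, `m = 3`. [folklore] -/
theorem st_saturated_succ_eq_biUnion (hp : p.totalDegree ≤ 3) (K : Finset (Fin n)) (j : Fin n) (hj : j ∈ K) (m : ℕ)
    (hK : #K = 3 * (m + 1)) :
    {S ∈ p.support.powerset | #S = m + 1 ∧ (S.biUnion fun s => s.support) = K} =
      (p.support.filter fun s₀ => j ∈ s₀.support ∧ s₀.support ⊆ K).biUnion fun s₀ =>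
        ({S' ∈ p.support.powerset | #S' = m ∧ (S'.biUnion fun s => s.support) = K \ s₀.support}).image
          (insert s₀) := by
  ext S
  constructor
  · intro hS
    obtain ⟨hSp', hS4, hSU⟩ := mem_filter.1 hS
    have hSp : S ⊆ p.support := mem_powerset.1 hSp'
    have h0 : j ∈ S.biUnion fun s => s.support := by rw [hSU]; exact hj
    obtain ⟨s₀, hs₀S, h0s₀⟩ := mem_biUnion.1 h0
    have hs₀K : s₀.support ⊆ K := by
      rw [← hSU]
      exact subset_biUnion_of_mem (fun s => s.support) hs₀S
    refine mem_biUnion.2 ⟨s₀, mem_filter.2 ⟨hSp hs₀S, h0s₀, hs₀K⟩,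
      mem_image.2 ⟨S.erase s₀, ?_, insert_erase hs₀S⟩⟩
    refine mem_filter.2 ⟨mem_powerset.2 ((erase_subset _ _).trans hSp), ?_, ?_⟩
    · rw [card_erase_of_mem hs₀S, hS4]
      rfl
    · symm
      apply eq_of_subset_of_card_le
      · intro i hi
        rw [mem_sdiff] at hi
        have hiU : i ∈ S.biUnion fun s => s.support := by rw [hSU]; exact hi.1
        obtain ⟨s, hsS, his⟩ := mem_biUnion.1 hiU
        have hss₀ : s ≠ s₀ := by
          rintro rfl
          exact hi.2 his
        exact mem_biUnion.2 ⟨s, mem_erase.2 ⟨hss₀, hsS⟩, his⟩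
      · have h9 : #((S.erase s₀).biUnion fun s => s.support) ≤ 3 * #(S.erase s₀) :=
          ax_card_biUnion_le hp ((erase_subset _ _).trans hSp)
        have h3 : #s₀.support ≤ 3 := ax_card_support_le hp (hSp hs₀S)
        have hsd : #(K \ s₀.support) = #K - #s₀.support := card_sdiff_of_subset hs₀K
        rw [card_erase_of_mem hs₀S, hS4] at h9
        rw [hsd]
        omega
  · intro hS
    obtain ⟨s₀, hs₀F, hSim⟩ := mem_biUnion.1 hS
    obtain ⟨hs₀p, h0s₀, hs₀K⟩ := mem_filter.1 hs₀F
    obtain ⟨S', hS'B, rfl⟩ := mem_image.1 hSim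
    obtain ⟨hS'p', hS'3, hS'U⟩ := mem_filter.1 hS'B
    have hS'p : S' ⊆ p.support := mem_powerset.1 hS'p'
    have hs₀S' : s₀ ∉ S' := by
      intro h
      have h0 : j ∈ S'.biUnion fun s => s.support := mem_biUnion.2 ⟨s₀, h, h0s₀⟩
      rw [hS'U, mem_sdiff] at h0
      exact h0.2 h0s₀
    refine mem_filter.2 ⟨mem_powerset.2 (insert_subset hs₀p hS'p), ?_, ?_⟩
    · rw [card_insert_of_notMem hs₀S', hS'3]
    · rw [biUnion_insert, hS'U, union_sdiff_of_subset hs₀K]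

/-- Counting version of `st_saturated_succ_eq_biUnion`: `N_{m+1}(K) = Σ_{s₀ ∋ j, supp s₀ ⊆ K} N_m(K ∖ supp s₀)` for
`|K| = 3(m+1)` and any pivot `j ∈ K`. [folklore] -/
theorem st_card_saturated_succ (hp : p.totalDegree ≤ 3) (K : Finset (Fin n)) (j : Fin n) (hj : j ∈ K) (m : ℕ)
    (hK : #K = 3 * (m + 1)) :
    #{S ∈ p.support.powerset | #S = m + 1 ∧ (S.biUnion fun s => s.support) = K} =
      ∑ s₀ ∈ p.support.filter (fun s₀ => j ∈ s₀.support ∧ s₀.support ⊆ K),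
        #{S' ∈ p.support.powerset | #S' = m ∧ (S'.biUnion fun s => s.support) = K \ s₀.support} := by
  -- no saturated `m`-set of `K ∖ supp s₀` contains a monomial through the pivot
  have key : ∀ s₀ ∈ p.support.filter (fun s₀ => j ∈ s₀.support ∧ s₀.support ⊆ K),
      ∀ S' ∈ {S' ∈ p.support.powerset | #S' = m ∧ (S'.biUnion fun s => s.support) = K \ s₀.support},
        ∀ s ∈ S', j ∉ s.support := by
    intro s₀ hs₀ S' hS' s hs h0
    have h0U : j ∈ S'.biUnion fun s => s.support := mem_biUnion.2 ⟨s, hs, h0⟩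
    rw [(mem_filter.1 hS').2.2, mem_sdiff] at h0U
    exact h0U.2 (mem_filter.1 hs₀).2.1
  have hdisj : ((p.support.filter fun s₀ => j ∈ s₀.support ∧ s₀.support ⊆ K : Finset _) : Set _).PairwiseDisjoint
      fun s₀ => ({S' ∈ p.support.powerset | #S' = m ∧ (S'.biUnion fun s => s.support) = K \ s₀.support}).image
        (insert s₀) := by
    intro s₀ hs₀ s₁ hs₁ hne
    rw [Function.onFun, disjoint_left]
    intro S hS hS1
    obtain ⟨S', hS', rfl⟩ := mem_image.1 hS
    obtain ⟨S'', hS'', hEq⟩ := mem_image.1 hS1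
    have hs₁S : s₁ ∈ insert s₀ S' := by
      rw [← hEq]
      exact mem_insert_self _ _
    rcases mem_insert.1 hs₁S with h | h
    · exact hne h.symm
    · exact key s₀ (mem_coe.1 hs₀) S' hS' s₁ h (mem_filter.1 (mem_coe.1 hs₁)).2.1
  rw [st_saturated_succ_eq_biUnion p hp K j hj m hK, card_biUnion hdisj]
  refine sum_congr rfl fun s₀ hs₀ => card_image_of_injOn fun S' hS' S'' hS'' h => ?_
  have h1 : s₀ ∉ S' := fun hm => key s₀ hs₀ S' (mem_coe.1 hS') s₀ hm (mem_filter.1 hs₀).2.1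
  have h2 : s₀ ∉ S'' := fun hm => key s₀ hs₀ S'' (mem_coe.1 hS'') s₀ hm (mem_filter.1 hs₀).2.1
  rw [← erase_insert h1, h, erase_insert h2]

/-- **Parity form of the recursion.** If `|K| = 3(m+1)`, `j ∈ K`, and for every monomial `s₀ ∋ j` of the cubic with
`supp s₀ ⊆ K` and `|supp s₀| = 3` the number `N_m(K ∖ supp s₀)` is even, then `N_{m+1}(K)` is even (monomials through `j`
with fewer than `3` variables contribute `N_m = 0` by `st_card_saturated_eq_zero`). [this work] -/
theorem st_even_saturated_succ (hp : p.totalDegree ≤ 3) (K : Finset (Fin n)) (j : Fin n) (hj : j ∈ K) (m : ℕ)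
    (hK : #K = 3 * (m + 1))
    (heven : ∀ s₀ ∈ p.support, j ∈ s₀.support → s₀.support ⊆ K → #s₀.support = 3 →
      Even #{S' ∈ p.support.powerset | #S' = m ∧ (S'.biUnion fun s => s.support) = K \ s₀.support}) :
    Even #{S ∈ p.support.powerset | #S = m + 1 ∧ (S.biUnion fun s => s.support) = K} := by
  rw [st_card_saturated_succ p hp K j hj m hK]
  refine even_sum _ fun s₀ hs₀ => ?_
  obtain ⟨hs₀p, hjs₀, hs₀K⟩ := mem_filter.1 hs₀
  by_cases h3 : #s₀.support = 3
  · exact heven s₀ hs₀p hjs₀ hs₀K h3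
  · have hle : #s₀.support ≤ 3 := ax_card_support_le hp hs₀p
    rw [st_card_saturated_eq_zero p hp (K \ s₀.support) m ?_]
    · exact ⟨0, rfl⟩
    · rw [card_sdiff_of_subset hs₀K]
      omega

end Summit.QuantumAdvantage.QuantumAdvantage.Theorems.CubicForrelation.NearExactIsExact

end
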